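import Literature.MathematicalPhysics.QuantumFieldTheory.Balaban1983to89.B9Cor35GDirAtCubeLetters

/-!
# `Balaban1983to89.B9Cor35GDirGStepCompressed` — [Balaban1985BackgroundPropagators] Corollary 3.5 p. 407 ∕ Theorem 3.4's `G`-clause FOR PRINT's DIRICHLET
# BOND CUBE LETTER `G_□` (p. 409 l. 3–5): THE (3.85)-MAJORANT AND THE `G`-STEP FROM A (3.84) SPLIT THAT HOLDS ONLY AFTER COMPRESSION TO THE BOND SET `B`
# — `𝟙♯·conj b((T(1) − T(Ṽ))♯)·𝟙♯ = 𝟙♯·(W⁰ + Σ_νW¹_ν∇_ν + P + A)·𝟙♯` — and the right-compression lemma `X ≺ K ⇒ X·𝟙♯ ≺ K`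
# (seat dag-n06-c g34, FILE F2a of road (B5)'s rest)

statement-level skeleton of published theorems with citation tags; proofs where landed; nothing here is a claim about the Yang–Mills mass gap

CITATION HEADER (lean-in-tree rule).  B9 = T. Bałaban, *Propagators for lattice gauge theories in a background field*, Commun. Math. Phys. **99** (1985)
389–434 [Balaban1985BackgroundPropagators] (held `paper:balaban1985-cmp99-background-propagators`; journal page = PDF page + 388): (3.82)–(3.86) p. 407
(«V(A) = Δ_a(U) − Δ_a(U′U) … G(U′U) = G(U) + G(U′U)V(A)G(U)»), p. 394 («Ω₀ denotes a characteristic function … Ω₀Δ′_aΩ₀»), Cor. 3.5 p. 407, Thm 3.4 p. 400,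
p. 409 l. 3–5 («G_□(U)»), p. 410 l. 14–15 («depend on U restricted to Ω₀(□)»).  [4] = [Balaban1984PropagatorsII] (2.51)–(2.55) p. 232, Lemma 2.1 (2.61) p. 234,
(2.66) p. 234.  Rows B9.Cor3.5 × B9.Thm3.4 × B9.Eq3.85 (cells only; no row head changes).

WHY THIS FILE (cell `pub-ymgap`, node N06 [B9]; dag-n06-d g35's LOCATED-35 «where to cut the small field»).  This seat's `G`-step at the Dirichlet bond letters
(✓`B9Cor35GDirAtCubeLetters.h385_dirB_of_pieces` ∕ `cor35_GDir_of_pieces` ∕ `cor35_GDir_rows_of_pieces`) takes the (3.84) split `conj b((T(1) − T(Ṽ))♯) = W⁰ +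
Σ_νW¹_ν∇_ν + P + A` as an identity of the UNCOMPRESSED operators on the whole torus.  For the letter of record the small field must be cut one layer BEYOND
`Ω₀(□)` (LOCATED-35: the Hessian's plaquettes through the bonds over `Ω₀` exit `Ω₀`), while the producers of the projection piece (✓`hPP_dirC_cube₀`) sit at the
field cut AT `Ω₀(□)`; the two `P`-words differ as whole-torus operators but COINCIDE after compression to `B = bondsOverY Ω₀(□)` (FILE F2b).  Since the (3.85)
product `V·GiK(1)` only sees `𝟙_B(T(1) − T(Ṽ))𝟙_B` (✓`VdK_eq_projK_mul`, ✓`projK_mul_GiK`), the split is needed only after compression.  THIS FILE re-presses the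
three theorems with the hypothesis `hsplit` replaced by the compressed identity `hsplitC : 𝟙♯·conj b((T(1) − T(Ṽ))♯)·𝟙♯ = 𝟙♯·(W⁰ + Σ_νW¹_ν∇_ν + P + A)·𝟙♯` —
every other binder and every conclusion BYTE-IDENTICAL — and adds the right-compression lemma (a majorant survives `X ↦ X·𝟙♯`, since `𝟙♯μ` has the block support
and bound of `μ`) needed to feed a compressed `P`-word.

WHAT IS PROVED (0 `def`s; theorems; 0 sorry; 0 new named facts; standard axioms):
* §1 `blockSupp_projK` (`𝟙♯μ` keeps the block support and the bound of `μ`), ★`hasMajorant_mul_projK` (`X ≺ K ⇒ X·𝟙♯ ≺ K`), `hasMajorant_projK_mul_mul_projK`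
  (`X ≺ K ⇒ 𝟙♯·X·𝟙♯ ≺ K`), `VdK_mul_GiK_eq_of_splitC` (`V·GiK(1) = 𝟙♯·((W⁰ + Σ_νW¹_ν∇_ν + P + A)·GiK(1))` from the compressed split);
* §2 ★★`h385_dirB_of_piecesC`, ★★★`cor35_GDir_of_piecesC`, ★★`cor35_GDir_rows_of_piecesC` (the three theorems of ✓`B9Cor35GDirAtCubeLetters` §2–§3 with `hsplit ↦ hsplitC`).

HONEST SCOPE / NOT CLAIMED.  Bookkeeping over landed modules (r05's `ineq385_op_dirs`, this seat's `gStep_dirB` ∕ `gStep_dirB_rows`) — all BY NAME; nothing of [B9]'s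
analysis is asserted.  DISPLAYED (hypotheses): the compressed split and the piece majorants, the `U = 1` rows `hG hDG` (FILE F1: conditional by name on
`B6.Prop26DirichletPrinted`), (2.61) twice, two scale transfers, the located smallness, the sockets `hT1 hKB`.  Nothing on `d = 4`, the continuum, reflection
positivity or the mass gap; NOT a node discharge; count-neutral; no row head changes.  NEW file; nothing landed is modified.  `--supports stmt-QuantumFields-27239`.

RELATED IN THE TREE, NOT DUPLICATED (searched 2026-08-31: `rg 'hasMajorant_mul_projK|of_piecesC|blockSupp_projK'` over `Literature/` + `Summits/` = ∅):
✓`B9Cor35GDirAtCubeLetters` (`hasMajorant_projK_mul` — LEFT compression; the uncompressed-split theorems), ✓`B9Cor35GDirGStep` (`projK`, `VdK_eq`, `gStep_dirB`).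
-/

noncomputable section

namespace Literature.MathematicalPhysics.QuantumFieldTheory.Balaban1983to89.B9Cor35GDirGStepCompressed

open B6RandomWalk (HasMajorant BlockSupp hasMajorant_mono Ineq261 c1_nonneg)
open B9Thm34Ext (toB6)
open B9Ineq347 (ScaleTransfer)
open B9Eq352DivFormLetters (conj conj_apply)
open B6KLevelCensusIndexV1 (KIdx)
open B6Cover236MultiLevelBlocks (cubes)
open B9CubeLettersBondOpsL0 (BlkCubeY)
open B9CubeGeometryInputs (geoCK geoCK_len_pos geoCK_dist_axioms)
open B9Cor35GCubeInputsAtOne (blkBK DK LapK)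
open B9Cor35GAtCubeLetters (kappa385d kappa385d_nonneg ineq385_op_dirs)
open B9Cor35GDirInputsAtOne (GdK GiK)
open B9Cor35GDirGStep (VdK VdK_eq projK projK_mul_projK gStep_dirB gStep_dirB_rows)
open B9Cor35GDirAtCubeLetters (projK_apply hasMajorant_projK_mul projK_mul_GiK VdK_eq_projK_mul)
open Node00 (FBondY CfgY toKT liftOpY)
open Node00.OpsYLocalInverse (dirPadY)
open Node00.OpsYCubeDirInverseBond (indProjY)
open scoped Matrix

variable {d ℓ : ℕ} {hd : 1 ≤ d + 1} {hL : Odd (ℓ + 1) ∧ 1 < ℓ + 1} {b₀ b₁ : ℝ}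

/-! ## §1  Right compression by `𝟙_B♯` costs nothing; the (3.85) product from a compressed split -/

section Compression

variable {𝔸 : Type} [NormedRing 𝔸] [NormedAlgebra ℂ 𝔸] [CompleteSpace 𝔸]
variable {ι : Type} [Fintype ι] (b : Module.Basis ι ℝ 𝔸)
variable (i : KIdx d ℓ hd hL b₀ b₁) (q : ↥(cubes (toKT i).D.toDomains))

omit [CompleteSpace 𝔸] in
/-- `𝟙♯μ` keeps the block support and the bound of `μ` (it only zeroes coordinates). [cite: Balaban1984PropagatorsII, (2.51) p.232; Balaban1985BackgroundPropagators, p.394, bookkeeping] -/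
theorem blockSupp_projK (B : Finset (FBondY i)) (Rr : ℝ) (H : Prop) {μ : FBondY i × ι → ℝ} {y' : BlkCubeY i q} {C : ℝ}
    (hμ : BlockSupp (g := toB6 (geoCK i q) Rr H) (blkBK i q) μ y' C) : BlockSupp (g := toB6 (geoCK i q) Rr H) (blkBK i q) (projK b i B μ) y' C := by
  refine ⟨hμ.nonneg, fun p hp => ?_, fun p hp => ?_⟩
  · rw [projK_apply]
    split_ifs
    · exact hμ.bound p hp
    · rw [abs_zero]; exact hμ.nonneg
  · rw [projK_apply, hμ.off p hp, ite_self]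

omit [CompleteSpace 𝔸] in
/-- ★ **RIGHT COMPRESSION KEEPS A BLOCK MAJORANT**: `X ≺ K ⇒ X·𝟙♯ ≺ K`. [cite: Balaban1984PropagatorsII, (2.51) p.232; Balaban1985BackgroundPropagators, p.394, bookkeeping] -/
theorem hasMajorant_mul_projK (B : Finset (FBondY i)) (Rr : ℝ) (H : Prop) {X : Module.End ℝ (FBondY i × ι → ℝ)} {K : BlkCubeY i q → BlkCubeY i q → ℝ}
    (hX : HasMajorant (g := toB6 (geoCK i q) Rr H) (blkBK i q) X K) :
    HasMajorant (g := toB6 (geoCK i q) Rr H) (blkBK i q) (X * projK b i B) K := fun y' μ C hμ p => by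
  rw [Module.End.mul_apply]
  exact hX y' (projK b i B μ) C (blockSupp_projK b i q B Rr H hμ) p

omit [CompleteSpace 𝔸] in
/-- two-sided compression keeps a block majorant: `X ≺ K ⇒ 𝟙♯·X·𝟙♯ ≺ K`. [cite: Balaban1984PropagatorsII, (2.51) p.232; Balaban1985BackgroundPropagators, p.394, bookkeeping] -/
theorem hasMajorant_projK_mul_mul_projK (B : Finset (FBondY i)) (Rr : ℝ) (H : Prop) {X : Module.End ℝ (FBondY i × ι → ℝ)}
    {K : BlkCubeY i q → BlkCubeY i q → ℝ} (hX : HasMajorant (g := toB6 (geoCK i q) Rr H) (blkBK i q) X K) :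
    HasMajorant (g := toB6 (geoCK i q) Rr H) (blkBK i q) (projK b i B * X * projK b i B) K :=
  hasMajorant_mul_projK b i q B Rr H (hasMajorant_projK_mul b i q B Rr H hX)

variable {T : CfgY 𝔸 i → ((FBondY i → 𝔸) →ₗ[ℂ] (FBondY i → 𝔸))} {B : Finset (FBondY i)}

/-- ★ **THE (3.85) PRODUCT FROM A COMPRESSED SPLIT**: if `𝟙♯·conj b((T(1) − T(Ṽ))♯)·𝟙♯ = 𝟙♯·R·𝟙♯`, then `V·GiK(1) = 𝟙♯·(R·GiK(1))` (`V = 𝟙♯·conj b(…)·𝟙♯`,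
`𝟙♯·GiK = GiK`). [cite: Balaban1985BackgroundPropagators, (3.84)–(3.85) p.407, p.394, bookkeeping] -/
theorem VdK_mul_GiK_eq_of_splitC (V : CfgY 𝔸 i) {R : Module.End ℝ (FBondY i × ι → ℝ)}
    (hsplitC : projK b i B * conj b ((T (fun _ _ => 1) - T V).restrictScalars ℝ) * projK b i B = projK b i B * R * projK b i B) :
    VdK b i T B V * GiK b i (T (fun _ _ => 1)) B = projK b i B * (R * GiK b i (T (fun _ _ => 1)) B) := by
  rw [VdK_eq_projK_mul, hsplitC, mul_assoc, mul_assoc, projK_mul_GiK]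

end Compression

/-! ## §2  The (3.85)-majorant, the `G`-step and the three rows from a compressed split -/

section H385

variable {𝔸 : Type} [NormedRing 𝔸] [NormedAlgebra ℂ 𝔸] [CompleteSpace 𝔸]
variable {ι : Type} [Fintype ι] (b : Module.Basis ι ℝ 𝔸)
variable (i : KIdx d ℓ hd hL b₀ b₁) (q : ↥(cubes (toKT i).D.toDomains))
variable {T : CfgY 𝔸 i → ((FBondY i → 𝔸) →ₗ[ℂ] (FBondY i → 𝔸))} {B : Finset (FBondY i)} {M KB : Matrix (FBondY i) (FBondY i) ℝ}

/-- ★★ **THE (3.85)-MAJORANT AT THE DIRICHLET BOND LETTERS FROM A COMPRESSED SPLIT** — ✓`h385_dirB_of_pieces` with `hsplit` replaced by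
`hsplitC : 𝟙♯·conj b((T(1) − T(Ṽ))♯)·𝟙♯ = 𝟙♯·(W⁰ + Σ_νW¹_ν∇_ν + P + A)·𝟙♯`; conclusion byte-identical.
[cite: Balaban1985BackgroundPropagators, (3.85) p.407, (3.73) p.405, (3.77) p.406, (3.83) p.407, Thm 3.3 p.399, p.409 l.3–5, p.394; Balaban1984PropagatorsII, Lemma 2.1 p.234, (2.52)–(2.55) p.232] -/
theorem h385_dirB_of_piecesC (Rr : ℝ) (H : Prop) (dB : ℕ) (δ₀ δ α β ρ Λ B₀ cW κ₁ κ₂ α₁ : ℝ)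
    (hB₀ : 0 ≤ B₀) (hcW : 0 ≤ cW) (hκ₁ : 0 ≤ κ₁) (hκ₂ : 0 ≤ κ₂) (hα₁ : 0 ≤ α₁) (hΛ : 0 ≤ Λ) (hρ : 0 ≤ ρ)
    (hα : 0 ≤ α) (hβ : 0 ≤ β) (hδ₀ : 0 ≤ δ₀) (hr : ρ + (α + β) * δ₀ ≤ δ)
    (h261 : Ineq261 dB (toB6 (geoCK i q) Rr H) δ₀ β)
    (hS1 : ScaleTransfer (geoCK i q) δ₀ α Λ (fun a => (geoCK i q).len a)) (hS2 : ScaleTransfer (geoCK i q) δ₀ α Λ (fun a => (geoCK i q).len a ^ 2))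
    (V : CfgY 𝔸 i)
    (hG : HasMajorant (g := toB6 (geoCK i q) Rr H) (blkBK i q) (GiK b i (T (fun _ _ => 1)) B)
      (fun a a' => B₀ * (geoCK i q).len a ^ 2 * Real.exp (-(δ * (geoCK i q).dist a a'))))
    (hDG : ∀ ν, HasMajorant (g := toB6 (geoCK i q) Rr H) (blkBK i q) (DK b i ν * GiK b i (T (fun _ _ => 1)) B)
      (fun a a' => B₀ * (geoCK i q).len a * Real.exp (-(δ * (geoCK i q).dist a a'))))
    {W0 PP AV : Module.End ℝ (FBondY i × ι → ℝ)} {W1 : Fin (d + 1) → Module.End ℝ (FBondY i × ι → ℝ)}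
    (hsplitC : projK b i B * conj b ((T (fun _ _ => 1) - T V).restrictScalars ℝ) * projK b i B =
      projK b i B * (W0 + ∑ ν, W1 ν * DK b i ν + PP + AV) * projK b i B)
    (hW0 : HasMajorant (g := toB6 (geoCK i q) Rr H) (blkBK i q) W0 (fun a a' => cW * α₁ * ((geoCK i q).len a ^ 2)⁻¹ * Real.exp (-(δ * (geoCK i q).dist a a'))))
    (hW1 : ∀ ν, HasMajorant (g := toB6 (geoCK i q) Rr H) (blkBK i q) (W1 ν) (fun a a' => cW * α₁ * ((geoCK i q).len a)⁻¹ * Real.exp (-(δ * (geoCK i q).dist a a'))))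
    (hPP : HasMajorant (g := toB6 (geoCK i q) Rr H) (blkBK i q) PP (fun a a' => κ₁ * α₁ * ((geoCK i q).len a ^ 2)⁻¹ * Real.exp (-(δ * (geoCK i q).dist a a'))))
    (hAv : HasMajorant (g := toB6 (geoCK i q) Rr H) (blkBK i q) AV (fun a a' => κ₂ * α₁ * ((geoCK i q).len a ^ 2)⁻¹ * Real.exp (-(δ * (geoCK i q).dist a a')))) :
    HasMajorant (g := toB6 (geoCK i q) Rr H) (blkBK i q) (VdK b i T B V * GiK b i (T (fun _ _ => 1)) B)
      (fun a a' => kappa385d B₀ cW κ₁ κ₂ Λ (B6.c1 dB δ₀ β) (d + 1) * α₁ * Real.exp (-(ρ * (geoCK i q).dist a a'))) := by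
  obtain ⟨hdnn, htri, -, -⟩ := geoCK_dist_axioms i q Rr H
  have h := ineq385_op_dirs (R := Rr) (H := H) (blkBK i q) dB δ₀ δ α β ρ Λ B₀ cW κ₁ κ₂ α₁ hB₀ hcW hκ₁ hκ₂ hα₁ hΛ hρ hα hβ hδ₀ hr hdnn htri
    (geoCK_len_pos i q) h261 hS1 hS2 hW0 hW1 hPP hAv hG hDG
  rw [VdK_mul_GiK_eq_of_splitC b i V hsplitC]
  refine hasMajorant_projK_mul b i q B Rr H ?_
  simpa [Fintype.card_fin] using h

/-- ★★★ **COROLLARY 3.5 ∕ THEOREM 3.4's `G`-CLAUSE FOR PRINT's DIRICHLET BOND CUBE LETTER, MODULO THE PIECES OF A COMPRESSED SPLIT** — ✓`cor35_GDir_of_pieces` with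
`hsplit ↦ hsplitC`; conclusions byte-identical: (i) `padΔ(Ṽ)` IS A UNIT; (ii) the two padded resolvent identities of (3.86) and the COMPRESSED one; (iii) every left
entry of `GiK(1)` at rate `ρ` transfers to `GiK(Ṽ)`.
[cite: Balaban1985BackgroundPropagators, Cor. 3.5 p.407, Thm 3.4 p.400, (3.84)–(3.86) p.407, Thm 3.3 p.399, (3.42) p.397, p.409 l.3–5, p.394; Balaban1984PropagatorsII, Lemma 2.1 p.234, (2.66) p.234] -/
theorem cor35_GDir_of_piecesC (hT1 : T (fun _ _ => 1) = liftOpY 𝔸 M)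
    (hKB : M.submatrix (fun v : ↥B => (v : FBondY i)) (fun v : ↥B => (v : FBondY i)) *
      KB.submatrix (fun v : ↥B => (v : FBondY i)) (fun v : ↥B => (v : FBondY i)) = 1)
    (Rr : ℝ) (H : Prop) (dB dB' : ℕ) (δ₀ δ α β ρ α' Λ B₀ cW κ₁ κ₂ α₁ : ℝ)
    (hB₀ : 0 ≤ B₀) (hcW : 0 ≤ cW) (hκ₁ : 0 ≤ κ₁) (hκ₂ : 0 ≤ κ₂) (hα₁ : 0 ≤ α₁) (hΛ : 0 ≤ Λ) (hρ : 0 ≤ ρ)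
    (hα : 0 ≤ α) (hβ : 0 ≤ β) (hδ₀ : 0 ≤ δ₀) (hr : ρ + (α + β) * δ₀ ≤ δ) (hα' : α' ≤ 1) (hα'ρ : 0 ≤ (1 - α') * ρ)
    (h261 : Ineq261 dB (toB6 (geoCK i q) Rr H) δ₀ β) (h261' : Ineq261 dB' (toB6 (geoCK i q) Rr H) ρ α')
    (hS1 : ScaleTransfer (geoCK i q) δ₀ α Λ (fun a => (geoCK i q).len a)) (hS2 : ScaleTransfer (geoCK i q) δ₀ α Λ (fun a => (geoCK i q).len a ^ 2))
    (hsmall : kappa385d B₀ cW κ₁ κ₂ Λ (B6.c1 dB δ₀ β) (d + 1) * α₁ * B6.c1 dB' ρ α' < 1)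
    (V : CfgY 𝔸 i)
    (hG : HasMajorant (g := toB6 (geoCK i q) Rr H) (blkBK i q) (GiK b i (T (fun _ _ => 1)) B)
      (fun a a' => B₀ * (geoCK i q).len a ^ 2 * Real.exp (-(δ * (geoCK i q).dist a a'))))
    (hDG : ∀ ν, HasMajorant (g := toB6 (geoCK i q) Rr H) (blkBK i q) (DK b i ν * GiK b i (T (fun _ _ => 1)) B)
      (fun a a' => B₀ * (geoCK i q).len a * Real.exp (-(δ * (geoCK i q).dist a a'))))
    {W0 PP AV : Module.End ℝ (FBondY i × ι → ℝ)} {W1 : Fin (d + 1) → Module.End ℝ (FBondY i × ι → ℝ)}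
    (hsplitC : projK b i B * conj b ((T (fun _ _ => 1) - T V).restrictScalars ℝ) * projK b i B =
      projK b i B * (W0 + ∑ ν, W1 ν * DK b i ν + PP + AV) * projK b i B)
    (hW0 : HasMajorant (g := toB6 (geoCK i q) Rr H) (blkBK i q) W0 (fun a a' => cW * α₁ * ((geoCK i q).len a ^ 2)⁻¹ * Real.exp (-(δ * (geoCK i q).dist a a'))))
    (hW1 : ∀ ν, HasMajorant (g := toB6 (geoCK i q) Rr H) (blkBK i q) (W1 ν) (fun a a' => cW * α₁ * ((geoCK i q).len a)⁻¹ * Real.exp (-(δ * (geoCK i q).dist a a'))))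
    (hPP : HasMajorant (g := toB6 (geoCK i q) Rr H) (blkBK i q) PP (fun a a' => κ₁ * α₁ * ((geoCK i q).len a ^ 2)⁻¹ * Real.exp (-(δ * (geoCK i q).dist a a'))))
    (hAv : HasMajorant (g := toB6 (geoCK i q) Rr H) (blkBK i q) AV (fun a a' => κ₂ * α₁ * ((geoCK i q).len a ^ 2)⁻¹ * Real.exp (-(δ * (geoCK i q).dist a a')))) :
    IsUnit (dirPadY (indProjY B) (T V)) ∧
    (GdK b i (T V) B = GdK b i (T (fun _ _ => 1)) B + GdK b i (T (fun _ _ => 1)) B * VdK b i T B V * GdK b i (T V) B ∧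
      GdK b i (T V) B = GdK b i (T (fun _ _ => 1)) B + GdK b i (T V) B * (VdK b i T B V * GdK b i (T (fun _ _ => 1)) B) ∧
      GiK b i (T V) B = GiK b i (T (fun _ _ => 1)) B + GiK b i (T V) B * (VdK b i T B V * GiK b i (T (fun _ _ => 1)) B)) ∧
    ∀ (X : Module.End ℝ (FBondY i × ι → ℝ)) (B₀' : ℝ) (P : BlkCubeY i q → ℝ), 0 ≤ B₀' → (∀ y, 0 ≤ P y) →
      HasMajorant (g := toB6 (geoCK i q) Rr H) (blkBK i q) (X * GiK b i (T (fun _ _ => 1)) B)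
        (fun a a' => B₀' * P a * Real.exp (-(ρ * (geoCK i q).dist a a'))) →
      HasMajorant (g := toB6 (geoCK i q) Rr H) (blkBK i q) (X * GiK b i (T V) B)
        (fun a a' => B₀' * B6.c1 dB' ρ α' * (1 - kappa385d B₀ cW κ₁ κ₂ Λ (B6.c1 dB δ₀ β) (d + 1) * α₁ * B6.c1 dB' ρ α')⁻¹ * P a *
          Real.exp (-((1 - α') * ρ * (geoCK i q).dist a a'))) := by
  have h385 := h385_dirB_of_piecesC b i q Rr H dB δ₀ δ α β ρ Λ B₀ cW κ₁ κ₂ α₁ hB₀ hcW hκ₁ hκ₂ hα₁ hΛ hρ hα hβ hδ₀ hr h261 hS1 hS2 V hG hDG hsplitC hW0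
    hW1 hPP hAv
  have hθ : 0 ≤ kappa385d B₀ cW κ₁ κ₂ Λ (B6.c1 dB δ₀ β) (d + 1) * α₁ := mul_nonneg (kappa385d_nonneg hB₀ hcW hκ₁ hκ₂ hΛ (c1_nonneg _ _ _)) hα₁
  exact gStep_dirB b i q hT1 hKB Rr H dB' hθ hρ hα' hα'ρ h261' hsmall V h385

/-- ★★ **THE THREE (3.42)-TYPE ROWS OF THE INTERIOR DIRICHLET BOND LETTER AT `Ṽ` FROM A COMPRESSED SPLIT** — ✓`cor35_GDir_rows_of_pieces` with `hsplit ↦ hsplitC`;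
conclusions byte-identical. [cite: Balaban1985BackgroundPropagators, Thm 3.4 p.400, Cor. 3.5 p.407, (3.42) p.397, p.409 l.3–5] -/
theorem cor35_GDir_rows_of_piecesC (hT1 : T (fun _ _ => 1) = liftOpY 𝔸 M)
    (hKB : M.submatrix (fun v : ↥B => (v : FBondY i)) (fun v : ↥B => (v : FBondY i)) *
      KB.submatrix (fun v : ↥B => (v : FBondY i)) (fun v : ↥B => (v : FBondY i)) = 1)
    (Rr : ℝ) (H : Prop) (dB dB' : ℕ) (δ₀ δ α β ρ α' Λ B₀ cW κ₁ κ₂ α₁ : ℝ)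
    (hB₀ : 0 ≤ B₀) (hcW : 0 ≤ cW) (hκ₁ : 0 ≤ κ₁) (hκ₂ : 0 ≤ κ₂) (hα₁ : 0 ≤ α₁) (hΛ : 0 ≤ Λ) (hρ : 0 ≤ ρ)
    (hα : 0 ≤ α) (hβ : 0 ≤ β) (hδ₀ : 0 ≤ δ₀) (hr : ρ + (α + β) * δ₀ ≤ δ) (hα' : α' ≤ 1) (hα'ρ : 0 ≤ (1 - α') * ρ)
    (h261 : Ineq261 dB (toB6 (geoCK i q) Rr H) δ₀ β) (h261' : Ineq261 dB' (toB6 (geoCK i q) Rr H) ρ α')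
    (hS1 : ScaleTransfer (geoCK i q) δ₀ α Λ (fun a => (geoCK i q).len a)) (hS2 : ScaleTransfer (geoCK i q) δ₀ α Λ (fun a => (geoCK i q).len a ^ 2))
    (hsmall : kappa385d B₀ cW κ₁ κ₂ Λ (B6.c1 dB δ₀ β) (d + 1) * α₁ * B6.c1 dB' ρ α' < 1)
    (V : CfgY 𝔸 i)
    (hG : HasMajorant (g := toB6 (geoCK i q) Rr H) (blkBK i q) (GiK b i (T (fun _ _ => 1)) B)
      (fun a a' => B₀ * (geoCK i q).len a ^ 2 * Real.exp (-(δ * (geoCK i q).dist a a'))))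
    (hDG : ∀ ν, HasMajorant (g := toB6 (geoCK i q) Rr H) (blkBK i q) (DK b i ν * GiK b i (T (fun _ _ => 1)) B)
      (fun a a' => B₀ * (geoCK i q).len a * Real.exp (-(δ * (geoCK i q).dist a a'))))
    {W0 PP AV : Module.End ℝ (FBondY i × ι → ℝ)} {W1 : Fin (d + 1) → Module.End ℝ (FBondY i × ι → ℝ)}
    (hsplitC : projK b i B * conj b ((T (fun _ _ => 1) - T V).restrictScalars ℝ) * projK b i B =
      projK b i B * (W0 + ∑ ν, W1 ν * DK b i ν + PP + AV) * projK b i B)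
    (hW0 : HasMajorant (g := toB6 (geoCK i q) Rr H) (blkBK i q) W0 (fun a a' => cW * α₁ * ((geoCK i q).len a ^ 2)⁻¹ * Real.exp (-(δ * (geoCK i q).dist a a'))))
    (hW1 : ∀ ν, HasMajorant (g := toB6 (geoCK i q) Rr H) (blkBK i q) (W1 ν) (fun a a' => cW * α₁ * ((geoCK i q).len a)⁻¹ * Real.exp (-(δ * (geoCK i q).dist a a'))))
    (hPP : HasMajorant (g := toB6 (geoCK i q) Rr H) (blkBK i q) PP (fun a a' => κ₁ * α₁ * ((geoCK i q).len a ^ 2)⁻¹ * Real.exp (-(δ * (geoCK i q).dist a a'))))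
    (hAv : HasMajorant (g := toB6 (geoCK i q) Rr H) (blkBK i q) AV (fun a a' => κ₂ * α₁ * ((geoCK i q).len a ^ 2)⁻¹ * Real.exp (-(δ * (geoCK i q).dist a a'))))
    {A : ℝ} (hA : 0 ≤ A)
    (hGρ : HasMajorant (g := toB6 (geoCK i q) Rr H) (blkBK i q) (GiK b i (T (fun _ _ => 1)) B)
      (fun a a' => A * (geoCK i q).len a ^ 2 * Real.exp (-(ρ * (geoCK i q).dist a a'))))
    (hDGρ : ∀ ν, HasMajorant (g := toB6 (geoCK i q) Rr H) (blkBK i q) (DK b i ν * GiK b i (T (fun _ _ => 1)) B)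
      (fun a a' => A * (geoCK i q).len a * Real.exp (-(ρ * (geoCK i q).dist a a'))))
    (hLapGρ : HasMajorant (g := toB6 (geoCK i q) Rr H) (blkBK i q) (LapK b i * GiK b i (T (fun _ _ => 1)) B)
      (fun a a' => A * Real.exp (-(ρ * (geoCK i q).dist a a')))) :
    HasMajorant (g := toB6 (geoCK i q) Rr H) (blkBK i q) (GiK b i (T V) B)
        (fun a a' => A * B6.c1 dB' ρ α' * (1 - kappa385d B₀ cW κ₁ κ₂ Λ (B6.c1 dB δ₀ β) (d + 1) * α₁ * B6.c1 dB' ρ α')⁻¹ * (geoCK i q).len a ^ 2 *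
          Real.exp (-((1 - α') * ρ * (geoCK i q).dist a a'))) ∧
    (∀ ν, HasMajorant (g := toB6 (geoCK i q) Rr H) (blkBK i q) (DK b i ν * GiK b i (T V) B)
        (fun a a' => A * B6.c1 dB' ρ α' * (1 - kappa385d B₀ cW κ₁ κ₂ Λ (B6.c1 dB δ₀ β) (d + 1) * α₁ * B6.c1 dB' ρ α')⁻¹ * (geoCK i q).len a *
          Real.exp (-((1 - α') * ρ * (geoCK i q).dist a a')))) ∧
    HasMajorant (g := toB6 (geoCK i q) Rr H) (blkBK i q) (LapK b i * GiK b i (T V) B)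
        (fun a a' => A * B6.c1 dB' ρ α' * (1 - kappa385d B₀ cW κ₁ κ₂ Λ (B6.c1 dB δ₀ β) (d + 1) * α₁ * B6.c1 dB' ρ α')⁻¹ * 1 *
          Real.exp (-((1 - α') * ρ * (geoCK i q).dist a a'))) := by
  have h385 := h385_dirB_of_piecesC b i q Rr H dB δ₀ δ α β ρ Λ B₀ cW κ₁ κ₂ α₁ hB₀ hcW hκ₁ hκ₂ hα₁ hΛ hρ hα hβ hδ₀ hr h261 hS1 hS2 V hG hDG hsplitC hW0
    hW1 hPP hAv
  have hθ : 0 ≤ kappa385d B₀ cW κ₁ κ₂ Λ (B6.c1 dB δ₀ β) (d + 1) * α₁ := mul_nonneg (kappa385d_nonneg hB₀ hcW hκ₁ hκ₂ hΛ (c1_nonneg _ _ _)) hα₁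
  exact gStep_dirB_rows b i q hT1 hKB Rr H dB' hθ hρ hα' hα'ρ h261' hsmall V h385 hA hGρ (DK b i) hDGρ (LapK b i) hLapGρ

end H385

end Literature.MathematicalPhysics.QuantumFieldTheory.Balaban1983to89.B9Cor35GDirGStepCompressed

end
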